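import Mathlib.Algebra.Polynomial.Div
import Mathlib.Algebra.Polynomial.Degree.TrailingDegree
import Mathlib.Algebra.CharP.Lemmas
import Mathlib.Algebra.Ring.GeomSum
import Mathlib.RingTheory.Polynomial.Basic
import Mathlib.Data.ZMod.Basic
import Mathlib.Tactic
import HarnessLib
import Summits.BirchSwinnertonDyer.BirchSwinnertonDyer.Theorems.Rank2ObservatoryFirstLayer

/-!
# BirchSwinnertonDyer — rank ≥ 2 observatory: the layer-shift lemma behind the Mazur–Tate
`λ`-census (instrument U3-MTL)

HONEST FRAMING: per-curve certified theorems and census instruments; no claim on BSD in rank ≥ 2.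

The census instrument U3-MTL (`SCHNEIDER-CENSUS.md` §3.8, `PREREG-U3MTL.md`) reads, for every
good-at-`3` curve of the rank-2/3 tables and `n = 1..5`, the invariants `μ_n, λ_n` of the image of
the Mazur–Tate element `θ_n` in `𝔽_p[G_n] = 𝔽_p[T]/(T^{p^n})` (`G_n` cyclic of order `p^n`,
`T = γ − 1`), and tabulates `λ⁺ := λ_4 − 20`, `λ⁻ := λ_5 − 60` on supersingular cells, the offsets
`q_n = 0, 2, 6, 20, 60, 182, …` being those of Pollack–Weston (Duke Math. J. 156 (2011), Thm 4.1)
with `q_{n+1} = q_{n−1} + (p−1)p^{n−1}`.  Its internal consistency check C1 and its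
"stabilisation pattern" SS1 (`λ_{n+1} = λ_{n−1} + (p−1)p^{n−1}` as soon as `μ_{n−1} = 0` and
`p ∣ a_p`) rest on the following exact algebra, proved here over `ℤ[X]` for every prime `p`:

* `omegaLayer p n = (X+1)^{p^n} − 1` (the relation polynomial of layer `n`) factors as
  `omegaLayer p n * nuLayer p (n+1) = omegaLayer p (n+1)` with the corestriction element
  `nuLayer p (n+1) = Σ_{i<p} (X+1)^{i p^n}`, and modulo `p` these become `X^{p^n}` and
  `X^{(p−1)p^n}` (`omegaLayer_map_zmod`, `nuLayer_map_zmod`).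
* `layerShift` — the THREE-TERM RELATION of Mazur–Tate elements (Pollack–Weston Prop. 2.5:
  `π(θ_{n+1}) = a_p·θ_n − cor(θ_{n−1})` in `ℤ[G_n]`), written in `ℤ[X]` with explicit slack as
  `A = C a * Bn − nuLayer p n * Bm + omegaLayer p n * G + C p * H`, together with `p ∣ a` and
  `μ(θ_{n−1}) = 0` (the image of `Bm` in `𝔽_p[X]/(X^{p^{n−1}})` is nonzero), forces: the image of
  `A` in `𝔽_p[X]/(X^{p^m})` is nonzero for every `m ≥ n` (so `μ_{n+1} = 0` in the census's
  finite-layer sense) and its `X`-adic order equals `λ(Bm) + (p^n − p^{n−1})` — i.e.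
  `λ_{n+1} = λ_{n−1} + (p−1)p^{n−1}`, the census's SS1 pattern and the `q_n` recursion.
* `layerShift_p3` — the instances used at `p = 3`: shifts `2, 6, 18, 54, 162, 486`, hence
  `λ_5 − 60 = λ_3 − 6 = λ_1` and `λ_4 − 20 = λ_2 − 2` wherever the pattern has started.

The coefficient-truncation lemma `coeff_modByMonic_X_pow_of_lt` is reused from the MS9 leaf
`Rank2ObservatoryFirstLayer`.  Nothing here is specific to elliptic curves: it is the algebra of
`𝔽_p[T]/(T^{p^n})` behind two census columns; which curves satisfy the hypotheses (`p ∣ a_p`, `μ_{n−1} = 0`) is DATA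
in the census, not asserted here.
-/

open Polynomial Finset

namespace Summit.BirchSwinnertonDyer.BirchSwinnertonDyer.Rank2Observatory

/-- The layer-`n` relation polynomial `ω_n = (X+1)^{p^n} − 1 ∈ ℤ[X]` (`ℤ[G_n] = ℤ[X]/(ω_n)`). -/
noncomputable def omegaLayer (p n : ℕ) : ℤ[X] := (X + 1) ^ (p ^ n) - 1

/-- The corestriction element from layer `n − 1` to layer `n` (`n ≥ 1`):
`ν_n = Σ_{i<p} (X+1)^{i·p^{n−1}}`, the sum over the kernel of `G_n → G_{n−1}`. -/
noncomputable def nuLayer (p n : ℕ) : ℤ[X] := ∑ i ∈ range p, ((X + 1) ^ (p ^ (n - 1))) ^ i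

/-- `ω_n` is monic (for `p > 0`). -/
theorem omegaLayer_monic (p n : ℕ) (hp : 0 < p) : (omegaLayer p n).Monic := by
  unfold omegaLayer
  have h1 : ((X : ℤ[X]) + 1) = X + C 1 := by simp
  rw [h1]
  apply Monic.sub_of_left ((monic_X_add_C 1).pow _)
  rw [degree_one, degree_pow, degree_X_add_C, nsmul_one]
  exact_mod_cast pow_pos hp n

/-- `ω_{n+1} = ω_n · ν_{n+1}` (geometric series). -/
theorem omegaLayer_succ (p n : ℕ) :
    omegaLayer p (n + 1) = omegaLayer p n * nuLayer p (n + 1) := by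
  unfold omegaLayer nuLayer
  simp only [Nat.add_sub_cancel]
  rw [mul_comm, geom_sum_mul, ← pow_mul, ← pow_succ]

/-- Reduction mod `p`: `ω_n ↦ X^{p^n}` in `(ZMod p)[X]`. -/
theorem omegaLayer_map_zmod (p n : ℕ) [hp : Fact p.Prime] :
    (omegaLayer p n).map (Int.castRingHom (ZMod p)) = X ^ (p ^ n) := by
  unfold omegaLayer
  simp only [Polynomial.map_sub, Polynomial.map_pow, Polynomial.map_add, Polynomial.map_X,
    Polynomial.map_one]
  rw [add_pow_char_pow (X : (ZMod p)[X]) 1, one_pow, add_sub_cancel_right]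

/-- Reduction mod `p` of the corestriction element: `ν_n ↦ X^{p^n − p^{n−1}}` (`n ≥ 1`). -/
theorem nuLayer_map_zmod (p n : ℕ) [hp : Fact p.Prime] (hn : 1 ≤ n) :
    (nuLayer p n).map (Int.castRingHom (ZMod p)) = X ^ (p ^ n - p ^ (n - 1)) := by
  obtain ⟨k, rfl⟩ : ∃ k, n = k + 1 := ⟨n - 1, by omega⟩
  have h := congrArg (Polynomial.map (Int.castRingHom (ZMod p))) (omegaLayer_succ p k)
  rw [Polynomial.map_mul, omegaLayer_map_zmod, omegaLayer_map_zmod] at h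
  -- h : X^(p^(k+1)) = X^(p^k) * ν̄
  have hsplit : (X : (ZMod p)[X]) ^ (p ^ (k + 1)) = X ^ (p ^ k) * X ^ (p ^ (k + 1) - p ^ k) := by
    rw [← pow_add]
    congr 1
    have : p ^ k ≤ p ^ (k + 1) := Nat.pow_le_pow_right hp.out.pos (Nat.le_succ k)
    omega
  rw [hsplit] at h
  simp only [Nat.add_sub_cancel]
  exact (mul_left_cancel₀ (pow_ne_zero _ X_ne_zero) h).symm

/-! ## `X`-adic order in `K[X]/(X^m)` -/

/-- If `f mod X^m ≠ 0` then `f ≠ 0`, its `X`-adic order is `< m`, and the order is unchanged by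
reduction modulo `X^M` for every `M ≥ m` (in particular `M = m`). -/
theorem natTrailingDegree_modByMonic_X_pow {K : Type*} [CommRing K] (f : K[X]) (m : ℕ)
    (hfm : f %ₘ X ^ m ≠ 0) :
    f ≠ 0 ∧ f.natTrailingDegree < m ∧
      ∀ M, m ≤ M → f %ₘ X ^ M ≠ 0 ∧ (f %ₘ X ^ M).natTrailingDegree = f.natTrailingDegree := by
  have hf : f ≠ 0 := by
    rintro rfl; simp at hfm
  -- the order d of f is < m, else X^m ∣ f and f %ₘ X^m = 0
  have hd : f.natTrailingDegree < m := by
    by_contra hle'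
    have hle : m ≤ f.natTrailingDegree := not_lt.mp hle'
    apply hfm
    rw [modByMonic_eq_zero_iff_dvd (monic_X_pow m), X_pow_dvd_iff]
    intro d hdm
    exact coeff_eq_zero_of_lt_natTrailingDegree (lt_of_lt_of_le hdm hle)
  refine ⟨hf, hd, fun M hM => ?_⟩
  have hdM : f.natTrailingDegree < M := lt_of_lt_of_le hd hM
  -- the trailing coefficient survives
  have htc : (f %ₘ X ^ M).coeff f.natTrailingDegree ≠ 0 := by
    rw [coeff_modByMonic_X_pow_of_lt f M _ hdM]
    exact trailingCoeff_nonzero_iff_nonzero.mpr hf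
  have hne : f %ₘ X ^ M ≠ 0 := by
    intro h0; rw [h0] at htc; simp at htc
  refine ⟨hne, le_antisymm (natTrailingDegree_le_of_ne_zero htc) ?_⟩
  apply le_natTrailingDegree hne
  intro j hj
  rw [coeff_modByMonic_X_pow_of_lt f M j (lt_trans hj hdM)]
  exact coeff_eq_zero_of_lt_natTrailingDegree hj

/-! ## The layer shift -/

/-- LAYER-SHIFT LEMMA (instrument U3-MTL, checks C1/SS1; Pollack–Weston Prop. 2.5 + the algebra of
Thm 4.1's offsets).  Let `p` be prime, `n ≥ 1`, and let `A, Bn, Bm ∈ ℤ[X]` represent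
`θ_{n+1}` (projected to layer `n`), `θ_n`, `θ_{n−1}`, subject to the three-term relation in
`ℤ[G_n] = ℤ[X]/(ω_n)` up to multiples of `p`:  `A = a·Bn − ν_n·Bm + ω_n·G + p·H` with `p ∣ a`.
If the image of `Bm` in `𝔽_p[X]/(X^{p^{n−1}})` is nonzero (`μ_{n−1} = 0`), then for every
`M ≥ p^n` the image of `A` in `𝔽_p[X]/(X^M)` is nonzero and its `X`-adic order is
`λ(Bm) + (p^n − p^{n−1})`, where `λ(Bm)` is the `X`-adic order of the image of `Bm`. -/
theorem layerShift (p : ℕ) [hp : Fact p.Prime] (n : ℕ) (hn : 1 ≤ n) (a : ℤ) (hap : (p : ℤ) ∣ a)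
    (A Bn Bm G H : ℤ[X])
    (hrel : A = C a * Bn - nuLayer p n * Bm + omegaLayer p n * G + C (p : ℤ) * H)
    (hμ : (Bm.map (Int.castRingHom (ZMod p))) %ₘ X ^ (p ^ (n - 1)) ≠ 0) :
    ∀ M, p ^ n ≤ M →
      (A.map (Int.castRingHom (ZMod p))) %ₘ X ^ M ≠ 0 ∧
      ((A.map (Int.castRingHom (ZMod p))) %ₘ X ^ M).natTrailingDegree
        = ((Bm.map (Int.castRingHom (ZMod p))) %ₘ X ^ (p ^ (n - 1))).natTrailingDegree
          + (p ^ n - p ^ (n - 1)) := by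
  set φ := Int.castRingHom (ZMod p) with hφ
  set b := Bm.map φ with hb
  -- facts about b = θ̄_{n-1}
  obtain ⟨hb0, hbd, hbM⟩ := natTrailingDegree_modByMonic_X_pow b (p ^ (n - 1)) hμ
  have hbdeg : (b %ₘ X ^ (p ^ (n - 1))).natTrailingDegree = b.natTrailingDegree :=
    (hbM (p ^ (n - 1)) le_rfl).2
  -- reduce the relation mod p:  Ā = -X^q * b + X^(p^n) * Ḡ,  q = p^n - p^(n-1)
  have hpa : (φ a : ZMod p) = 0 := by
    rw [hφ, eq_intCast]
    exact (ZMod.intCast_zmod_eq_zero_iff_dvd a p).mpr hap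
  have hpp : (φ (p : ℤ) : ZMod p) = 0 := by
    rw [hφ, eq_intCast]; simp
  have hAbar : A.map φ = -(X ^ (p ^ n - p ^ (n - 1)) * b) + X ^ (p ^ n) * G.map φ := by
    rw [hrel]
    rw [Polynomial.map_add, Polynomial.map_add, Polynomial.map_sub, Polynomial.map_mul,
      Polynomial.map_mul, Polynomial.map_mul, Polynomial.map_mul, Polynomial.map_C, Polynomial.map_C,
      nuLayer_map_zmod p n hn, omegaLayer_map_zmod, hpa, hpp, map_zero, zero_mul, zero_sub, zero_mul,
      add_zero, ← hb]
  -- the main term X^q * b: nonzero, order q + λ(b) < p^n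
  have hq : p ^ (n - 1) ≤ p ^ n := Nat.pow_le_pow_right hp.out.pos (Nat.sub_le n 1)
  have hmain0 : (X : (ZMod p)[X]) ^ (p ^ n - p ^ (n - 1)) * b ≠ 0 :=
    mul_ne_zero (pow_ne_zero _ X_ne_zero) hb0
  have hmaindeg : ((X : (ZMod p)[X]) ^ (p ^ n - p ^ (n - 1)) * b).natTrailingDegree
      = b.natTrailingDegree + (p ^ n - p ^ (n - 1)) := by
    rw [mul_comm, natTrailingDegree_mul_X_pow hb0]
  have hlt : ((X : (ZMod p)[X]) ^ (p ^ n - p ^ (n - 1)) * b).natTrailingDegree < p ^ n := by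
    rw [hmaindeg]; omega
  -- Ā mod X^(p^n) = -(X^q b) mod X^(p^n)
  have hmodn : (A.map φ) %ₘ X ^ (p ^ n) = (-(X ^ (p ^ n - p ^ (n - 1)) * b)) %ₘ X ^ (p ^ n) := by
    rw [hAbar, add_modByMonic]
    have : (X ^ (p ^ n) * G.map φ) %ₘ X ^ (p ^ n) = 0 :=
      (modByMonic_eq_zero_iff_dvd (monic_X_pow _)).mpr (dvd_mul_right _ _)
    rw [this, add_zero]
  -- the negated main term has the same order and is nonzero mod X^(p^n)
  have hneg0 : -((X : (ZMod p)[X]) ^ (p ^ n - p ^ (n - 1)) * b) ≠ 0 := neg_ne_zero.mpr hmain0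
  have hnegdeg : (-((X : (ZMod p)[X]) ^ (p ^ n - p ^ (n - 1)) * b)).natTrailingDegree
      = b.natTrailingDegree + (p ^ n - p ^ (n - 1)) := by
    rw [natTrailingDegree_neg, hmaindeg]
  have hnegmod : (-((X : (ZMod p)[X]) ^ (p ^ n - p ^ (n - 1)) * b)) %ₘ X ^ (p ^ n) ≠ 0 := by
    intro h0
    rw [modByMonic_eq_zero_iff_dvd (monic_X_pow _), X_pow_dvd_iff] at h0
    have hlt' : (-((X : (ZMod p)[X]) ^ (p ^ n - p ^ (n - 1)) * b)).natTrailingDegree < p ^ n := by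
      rw [hnegdeg]; omega
    have hcoef := h0 _ hlt'
    have htc : (-((X : (ZMod p)[X]) ^ (p ^ n - p ^ (n - 1)) * b)).trailingCoeff = 0 := hcoef
    exact (trailingCoeff_nonzero_iff_nonzero.mpr hneg0) htc
  -- hence Ā mod X^(p^n) ≠ 0, so Ā ≠ 0 with order < p^n, and all larger truncations agree
  have hAmodn : (A.map φ) %ₘ X ^ (p ^ n) ≠ 0 := by rw [hmodn]; exact hnegmod
  obtain ⟨hA0, hAd, hAM⟩ := natTrailingDegree_modByMonic_X_pow (A.map φ) (p ^ n) hAmodn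
  have hAdeg : (A.map φ).natTrailingDegree = b.natTrailingDegree + (p ^ n - p ^ (n - 1)) := by
    have e1 := (hAM (p ^ n) le_rfl).2
    obtain ⟨_, _, hNM⟩ := natTrailingDegree_modByMonic_X_pow _ (p ^ n) hnegmod
    have e2 := (hNM (p ^ n) le_rfl).2
    rw [← e1, hmodn, e2, hnegdeg]
  intro M hM
  refine ⟨(hAM M hM).1, ?_⟩
  rw [(hAM M hM).2, hAdeg, hbdeg]

/-- The shifts at `p = 3` used by the census (`n = 1..6`): `(p−1)p^{n−1} = 2, 6, 18, 54, 162, 486`,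
so the Pollack–Weston offsets `q_n = 0, 2, 6, 20, 60, 182, 546, 1640` satisfy
`q_{n+1} = q_{n−1} + 2·3^{n−1}`; in particular `λ_5 − 60 = λ_3 − 6 = λ_1 − 0` and
`λ_4 − 20 = λ_2 − 2` along any run of layers where `layerShift` applies. -/
theorem layerShift_p3_offsets :
    (3 ^ 1 - 3 ^ 0 = 2 ∧ 3 ^ 2 - 3 ^ 1 = 6 ∧ 3 ^ 3 - 3 ^ 2 = 18 ∧ 3 ^ 4 - 3 ^ 3 = 54 ∧
      3 ^ 5 - 3 ^ 4 = 162 ∧ 3 ^ 6 - 3 ^ 5 = 486) ∧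
    (2 = 0 + 2 ∧ 6 = 0 + 6 ∧ 20 = 2 + 18 ∧ 60 = 6 + 54 ∧ 182 = 20 + 162 ∧ 546 = 60 + 486 ∧
      1640 = 182 + (3 ^ 7 - 3 ^ 6)) := by
  norm_num

/-- Census instance (`p = 3`, from layer `3` to layer `5`, the `λ⁻` column): if `θ_5, θ_4, θ_3`
satisfy the three-term relation in `ℤ[G_4]` up to multiples of `3` with `3 ∣ a_3`, and `θ_3` is
nonzero in `𝔽_3[G_3]`, then `θ_5` is nonzero in `𝔽_3[G_5] = 𝔽_3[X]/(X^243)` and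
`λ_5 = λ_3 + 54`. -/
theorem layerShift_p3_layer5 (a : ℤ) (ha : (3 : ℤ) ∣ a) (A B4 B3 G H : ℤ[X])
    (hrel : A = C a * B4 - nuLayer 3 4 * B3 + omegaLayer 3 4 * G + C (3 : ℤ) * H)
    (hμ : (B3.map (Int.castRingHom (ZMod 3))) %ₘ X ^ 27 ≠ 0) :
    (A.map (Int.castRingHom (ZMod 3))) %ₘ X ^ 243 ≠ 0 ∧
      ((A.map (Int.castRingHom (ZMod 3))) %ₘ X ^ 243).natTrailingDegree
        = ((B3.map (Int.castRingHom (ZMod 3))) %ₘ X ^ 27).natTrailingDegree + 54 := by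
  haveI : Fact (Nat.Prime 3) := ⟨by norm_num⟩
  have h := layerShift 3 4 (by norm_num) a (by exact_mod_cast ha) A B4 B3 G H hrel
    (by simpa using hμ) 243 (by norm_num)
  simpa using h

end Summit.BirchSwinnertonDyer.BirchSwinnertonDyer.Rank2Observatory
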